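import Summits.NavierStokesRegularity.FunctionalMining.NoGo.StretchingSupNotSharpCore
import HarnessLib

/-!
(Part 3/3 of the no-go seat's staged `StretchingSupNotSharp` — split by the prove seat for the 400-line cap; this part: the `L⁴` Calderón–Zygmund bound on `T³` and the final `not_stretchingSupSharp_fin3`, `exists_stretchingSupBound_lt_holder`.)
# Functional mining: Hölder's constant `2/√3` is NOT sharp — `StretchingSupSharp` fails (K1-Q1)

Search for candidate a priori estimates; no regularity claim.

Cell `pub-nsfunc`, no-go seat (gen 5), STAGED for the prove seat (target tree path
`Summits/NavierStokesRegularity/FunctionalMining/NoGo/StretchingSupNotSharp.lean`). Paper write-up: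
`HOME/pub-nsfunc-nogo/K1Q1.md` [ours, UNREVIEWED].

THEOREM (static, on `𝕋³`). If `K ≥ 0` is a constant with `∫|S|_F⁴ ≤ K ∫|ω|⁴` for all smooth
divergence-free `v` (`StrainL4Bound K`; such a `K` exists by the periodic Calderón–Zygmund
inequality, tree `BDSV.exists_eLpNorm_twoStrain_le_curl` at `p = 4`), then the static stretching
bound holds with a constant STRICTLY below Hölder's:
`StretchingSupBound (2/√3 − 1/(4√3(4K+1)))` (`stretchingSupBound_of_strainL4Bound`). Hence
`StrainL4Bound K → ¬ StretchingSupSharp` (`not_stretchingSupSharp_of_strainL4Bound`), and — the `L⁴`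
bound being a tree theorem on `T³` (`exists_strainL4Bound_fin3`, `K = (2187/16)·C₄⁴`) —
UNCONDITIONALLY `¬ StretchingSupSharp (d := Fin 3)` (`not_stretchingSupSharp_fin3`), equivalently
`∃ C < 2/√3, StretchingSupBound (d := Fin 3) C` (`exists_stretchingSupBound_lt_holder`). The
dictionary question K1-Q1 ("is Hölder's `2/√3` the optimal static constant?") is thereby DECIDED: no.
The improvement `δ = 1/(4√3(4K+1))` is not numerically explicit (the tree's Calderón–Zygmund constant
`C₄` is existential); the optimal constant remains unknown (numerical evidence `≈ 0.25`, NOGO.md §1).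

MECHANISM. (E1) Hölder with the Cauchy–Schwarz deficit: `σ ≤ (M/√3)(2ℰ − ½∫(√2|S| − |ω|)²)`
(pointwise `ωᵀSω ≤ M√(2/3)|S||ω| = (M/√3)(|S|² + ½|ω|² − ½(√2|S| − |ω|)²)`).
(E2) Betchov–Miller `σ = −4∫det S ≤ (2√6/9)∫|S|³` (tree `neg_integral_stretching_le_strain_cube`)
and `|S|³ ≤ ½M|S||ω| + …`, the remainder being `≤ (M/4t)(√2|S|−|ω|)² + (t/4M)(4|S|⁴ + 2|S|²|ω|²)`
pointwise (Young), whose integral the `L⁴` bound controls: `σ ≤ (2√6/9)M[ℰ/√2 + Δ/(4t) + t(2K+½)ℰ]`,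
`Δ = ∫(√2|S| − |ω|)²`. With `t = 1/(8K+2)`: if `Δ ≥ ℰ/(8K+2)` then (E1) gives the constant
`2/√3 − 1/(4√3(4K+1))`; otherwise (E2) gives `(2√6/9)(1/√2 + ½) ≈ 0.657`. No time, no solutions.
-/

noncomputable section

open Set MeasureTheory Finset
open scoped InnerProductSpace RealInnerProductSpace ENNReal NNReal

namespace Summit.NavierStokesRegularity.FunctionalMining

open Literature.Analysis.FunctionSpaces Literature.Analysis.FluidPDE

variable {d : Type*} [Fintype d] [DecidableEq d]

/-! ## The `L⁴` bound holds on `T³` (periodic Calderón–Zygmund, from the tree) -/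

section L4

/-- `∑ₗ (curl v)ₗ² = |ω|²` on `T³` (the tree's `torusVorticitySqAt` at `d = Fin 3`). [folklore] -/
theorem sum_curl_sq_eq_torusVorticitySqAt (v : UnitAddTorus (Fin 3) → EuclideanSpace ℝ (Fin 3))
    (x : UnitAddTorus (Fin 3)) : ∑ l, (BDSV.curl v x l) ^ 2 = torusVorticitySqAt v x := by
  simp only [torusVorticitySqAt, Fin.sum_univ_three, BDSV.curl_apply_zero, BDSV.curl_apply_one,
    BDSV.curl_apply_two]
  ring

/-- Power mean: `(x+y+z)⁴ ≤ 27(x⁴+y⁴+z⁴)`. [folklore] -/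
theorem add_three_pow_four_le (x y z : ℝ) : (x + y + z) ^ 4 ≤ 27 * (x ^ 4 + y ^ 4 + z ^ 4) := by
  have hQ : (x + y + z) ^ 2 ≤ 3 * (x ^ 2 + y ^ 2 + z ^ 2) := by
    nlinarith [sq_nonneg (x - y), sq_nonneg (y - z), sq_nonneg (x - z)]
  have hQ2 : (x ^ 2 + y ^ 2 + z ^ 2) ^ 2 ≤ 3 * (x ^ 4 + y ^ 4 + z ^ 4) := by
    nlinarith [sq_nonneg (x ^ 2 - y ^ 2), sq_nonneg (y ^ 2 - z ^ 2), sq_nonneg (x ^ 2 - z ^ 2)]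
  calc (x + y + z) ^ 4 = ((x + y + z) ^ 2) ^ 2 := by ring
    _ ≤ (3 * (x ^ 2 + y ^ 2 + z ^ 2)) ^ 2 := pow_le_pow_left₀ (sq_nonneg _) hQ 2
    _ = 9 * (x ^ 2 + y ^ 2 + z ^ 2) ^ 2 := by ring
    _ ≤ 27 * (x ^ 4 + y ^ 4 + z ^ 4) := by linarith

/-- For continuous real `f` on `T³`: `‖f‖_{L⁴} = (∫ f⁴)^{1/4}`. [folklore] -/
theorem eLpNorm_four_eq_ofReal {f : UnitAddTorus (Fin 3) → ℝ} (hf : Continuous f) :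
    eLpNorm f 4 volume = ENNReal.ofReal ((∫ x, f x ^ 4) ^ (4⁻¹ : ℝ)) := by
  obtain ⟨B, hB⟩ := isCompact_univ.exists_bound_of_continuousOn hf.continuousOn
  have hmem : MemLp f 4 volume :=
    (memLp_top_of_bound hf.aestronglyMeasurable B
      (Filter.Eventually.of_forall fun y => hB y (mem_univ y))).mono_exponent le_top
  rw [hmem.eLpNorm_eq_integral_rpow_norm (by norm_num) (by norm_num)]
  have h4 : (4 : ℝ≥0∞).toReal = 4 := by norm_num
  rw [h4]
  have e : ∫ y, ‖f y‖ ^ (4 : ℝ) = ∫ y, f y ^ 4 := by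
    refine integral_congr_ae (Filter.Eventually.of_forall fun y => ?_)
    have h4' : ‖f y‖ ^ (4 : ℝ) = ‖f y‖ ^ (4 : ℕ) := by exact_mod_cast Real.rpow_natCast ‖f y‖ 4
    show ‖f y‖ ^ (4 : ℝ) = f y ^ 4
    rw [h4', Real.norm_eq_abs]
    have : |f y| ^ 4 = (|f y| ^ 2) ^ 2 := by ring
    rw [this, sq_abs]
    ring
  rw [e]

/-- **The `L⁴` Calderón–Zygmund bound holds on `T³`**: `∃ K ≥ 0, ∫|S|⁴ ≤ K∫|ω|⁴` for all smooth
divergence-free fields — `K = (2187/16)·C₄⁴` with `C₄` the tree's `L⁴` strain/curl constant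
(`BDSV.exists_eLpNorm_twoStrain_le_curl` at `p = 4`; Majda–Bertozzi 2002 (11.9), periodic
Calderón–Zygmund); bookkeeping `|S|⁴ ≤ (9/16)∑ᵢⱼ(2Sᵢⱼ)⁴`, `(∑ₗaₗ)⁴ ≤ 27∑ₗaₗ⁴`, `∑ₗωₗ⁴ ≤ |ω|⁴`.
[folklore] -/
theorem exists_strainL4Bound_fin3 : ∃ K : ℝ, 0 ≤ K ∧ StrainL4Bound (d := Fin 3) K := by
  obtain ⟨C, hC⟩ := BDSV.exists_eLpNorm_twoStrain_le_curl (p := 4) (by norm_num) (by norm_num)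
  refine ⟨2187 / 16 * (C : ℝ) ^ 4, by positivity, ?_⟩
  intro _ v hv hdiv
  have hD : ∀ m, Torus.IsSmooth (Torus.partialDeriv m v) := fun m => hv.partialDeriv m
  have hDc : ∀ m j, Continuous (fun y => Torus.partialDeriv m v y j) :=
    fun m j => ((hD m).apply j).continuous
  set a : Fin 3 → Fin 3 → UnitAddTorus (Fin 3) → ℝ :=
    fun i j x => Torus.partialDeriv i v x j + Torus.partialDeriv j v x i with ha
  set w : Fin 3 → UnitAddTorus (Fin 3) → ℝ := fun l x => BDSV.curl v x l with hw
  have hac : ∀ i j, Continuous (a i j) := fun i j => (hDc i j).add (hDc j i)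
  have hwc : ∀ l, Continuous (w l) := fun l => ((BDSV.isSmooth_curl hv).apply l).continuous
  have hA0 : ∀ i j, 0 ≤ ∫ x, a i j x ^ 4 := fun i j => integral_nonneg fun x => by positivity
  have hW0 : ∀ l, 0 ≤ ∫ x, w l x ^ 4 := fun l => integral_nonneg fun x => by positivity
  -- Step 1: the `L⁴` inequality as a real inequality
  have h1 : ∀ i j, (∫ x, a i j x ^ 4) ^ (4⁻¹ : ℝ) ≤ C * ∑ l, (∫ x, w l x ^ 4) ^ (4⁻¹ : ℝ) := by
    intro i j
    have h := hC v hv hdiv i j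
    have hl : eLpNorm (fun x => Torus.partialDeriv i v x j + Torus.partialDeriv j v x i) 4 volume =
        ENNReal.ofReal ((∫ x, a i j x ^ 4) ^ (4⁻¹ : ℝ)) := eLpNorm_four_eq_ofReal (hac i j)
    have hr : ∑ l, eLpNorm (fun x => BDSV.curl v x l) 4 volume =
        ENNReal.ofReal (∑ l, (∫ x, w l x ^ 4) ^ (4⁻¹ : ℝ)) := by
      rw [ENNReal.ofReal_sum_of_nonneg (fun l _ => Real.rpow_nonneg (hW0 l) _)]
      exact Finset.sum_congr rfl fun l _ => eLpNorm_four_eq_ofReal (hwc l)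
    have hnn : 0 ≤ (C : ℝ) * ∑ l, (∫ x, w l x ^ 4) ^ (4⁻¹ : ℝ) :=
      mul_nonneg C.coe_nonneg (Finset.sum_nonneg fun l _ => Real.rpow_nonneg (hW0 l) _)
    rw [hl, hr, ← ENNReal.ofReal_coe_nnreal, ← ENNReal.ofReal_mul C.coe_nonneg] at h
    exact (ENNReal.ofReal_le_ofReal_iff hnn).1 h
  -- Step 2: fourth powers, `∫ aᵢⱼ⁴ ≤ 27 C⁴ ∑ₗ ∫ ωₗ⁴`
  have h2 : ∀ i j, ∫ x, a i j x ^ 4 ≤ 27 * (C : ℝ) ^ 4 * ∑ l, ∫ x, w l x ^ 4 := by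
    intro i j
    set r : Fin 3 → ℝ := fun l => (∫ x, w l x ^ 4) ^ (4⁻¹ : ℝ) with hr
    have hr4 : ∀ l, r l ^ 4 = ∫ x, w l x ^ 4 := fun l => by
      simp only [hr]
      rw [show (4⁻¹ : ℝ) = ((4 : ℕ) : ℝ)⁻¹ by norm_num]
      exact Real.rpow_inv_natCast_pow (hW0 l) (by norm_num)
    have hA4 : ((∫ x, a i j x ^ 4) ^ (4⁻¹ : ℝ)) ^ 4 = ∫ x, a i j x ^ 4 := by
      rw [show (4⁻¹ : ℝ) = ((4 : ℕ) : ℝ)⁻¹ by norm_num]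
      exact Real.rpow_inv_natCast_pow (hA0 i j) (by norm_num)
    have hle : (∫ x, a i j x ^ 4) ^ (4⁻¹ : ℝ) ≤ C * ∑ l, r l := h1 i j
    have hpow := pow_le_pow_left₀ (Real.rpow_nonneg (hA0 i j) _) hle 4
    rw [hA4] at hpow
    have hsum : (∑ l, r l) ^ 4 ≤ 27 * ∑ l, r l ^ 4 := by
      simp only [Fin.sum_univ_three]
      exact add_three_pow_four_le _ _ _
    calc ∫ x, a i j x ^ 4 ≤ (C * ∑ l, r l) ^ 4 := hpow
      _ = (C : ℝ) ^ 4 * (∑ l, r l) ^ 4 := by ring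
      _ ≤ (C : ℝ) ^ 4 * (27 * ∑ l, r l ^ 4) := mul_le_mul_of_nonneg_left hsum (by positivity)
      _ = 27 * (C : ℝ) ^ 4 * ∑ l, ∫ x, w l x ^ 4 := by
          rw [Finset.sum_congr rfl fun l _ => hr4 l]; ring
  -- Step 3: `∑ₗ ∫ ωₗ⁴ ≤ ∫ |ω|⁴`
  have hwi : ∀ l, Integrable (fun x => w l x ^ 4) := fun l =>
    ((hwc l).pow 4).integrable_unitAddTorus
  have hqc : Continuous (fun x => torusVorticitySqAt v x) := by
    have : (fun x => torusVorticitySqAt v x) = fun x => ∑ l, (w l x) ^ 2 :=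
      funext fun x => (sum_curl_sq_eq_torusVorticitySqAt v x).symm
    rw [this]
    exact continuous_finsetSum _ fun l _ => (hwc l).pow 2
  have h3 : ∑ l, ∫ x, w l x ^ 4 ≤ ∫ x, torusVorticitySqAt v x ^ 2 := by
    rw [← integral_finsetSum _ (fun l _ => hwi l)]
    refine integral_mono (integrable_finsetSum _ fun l _ => hwi l)
      ((hqc.pow 2).integrable_unitAddTorus) fun x => ?_
    show ∑ l, w l x ^ 4 ≤ torusVorticitySqAt v x ^ 2
    rw [← sum_curl_sq_eq_torusVorticitySqAt v x]
    simp only [hw, Fin.sum_univ_three]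
    nlinarith [mul_nonneg (sq_nonneg (BDSV.curl v x 0)) (sq_nonneg (BDSV.curl v x 1)),
      mul_nonneg (sq_nonneg (BDSV.curl v x 1)) (sq_nonneg (BDSV.curl v x 2)),
      mul_nonneg (sq_nonneg (BDSV.curl v x 0)) (sq_nonneg (BDSV.curl v x 2))]
  -- Step 4: `|S|⁴ ≤ (9/16) ∑ᵢⱼ aⱼᵢ⁴` pointwise, then integrate
  have hXeq : ∀ x, strainNormSqAt v x = ∑ i, ∑ j, (a j i x / 2) ^ 2 := fun x => by
    simp only [strainNormSqAt, ha]
  have hX : ∀ x, strainNormSqAt v x ^ 2 ≤ 9 / 16 * ∑ i, ∑ j, a j i x ^ 4 := by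
    intro x
    have hcs1 : (∑ i, ∑ j, (a j i x / 2) ^ 2) ^ 2 ≤ 3 * ∑ i, (∑ j, (a j i x / 2) ^ 2) ^ 2 := by
      have := sq_sum_le_card_mul_sum_sq (s := (Finset.univ : Finset (Fin 3)))
        (f := fun i => ∑ j, (a j i x / 2) ^ 2)
      simpa [Finset.card_univ, Fintype.card_fin] using this
    have hcs2 : ∀ i, (∑ j, (a j i x / 2) ^ 2) ^ 2 ≤ 3 * ∑ j, ((a j i x / 2) ^ 2) ^ 2 := fun i => by
      have := sq_sum_le_card_mul_sum_sq (s := (Finset.univ : Finset (Fin 3)))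
        (f := fun j => (a j i x / 2) ^ 2)
      simpa [Finset.card_univ, Fintype.card_fin] using this
    rw [hXeq x]
    calc (∑ i, ∑ j, (a j i x / 2) ^ 2) ^ 2 ≤ 3 * ∑ i, (∑ j, (a j i x / 2) ^ 2) ^ 2 := hcs1
      _ ≤ 3 * ∑ i, (3 * ∑ j, ((a j i x / 2) ^ 2) ^ 2) := by
          apply mul_le_mul_of_nonneg_left _ (by norm_num : (0 : ℝ) ≤ 3)
          exact Finset.sum_le_sum fun i _ => hcs2 i
      _ = 9 / 16 * ∑ i, ∑ j, a j i x ^ 4 := by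
          simp only [Finset.mul_sum]
          refine Finset.sum_congr rfl fun i _ => Finset.sum_congr rfl fun j _ => ?_
          ring
  have haI : ∀ i j, Integrable (fun x => a j i x ^ 4) := fun i j =>
    ((hac j i).pow 4).integrable_unitAddTorus
  have haI2 : ∀ i, Integrable (fun x => ∑ j, a j i x ^ 4) := fun i =>
    integrable_finsetSum _ fun j _ => haI i j
  have hSc : Continuous (fun x => strainNormSqAt v x) := by
    have : (fun x => strainNormSqAt v x) = fun x => ∑ i, ∑ j, (a j i x / 2) ^ 2 := funext hXeq
    rw [this]
    exact continuous_finsetSum _ fun i _ => continuous_finsetSum _ fun j _ =>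
      ((hac j i).div_const _).pow 2
  have hRi : Integrable (fun x => 9 / 16 * ∑ i, ∑ j, a j i x ^ 4) :=
    (integrable_finsetSum _ fun i _ => haI2 i).const_mul _
  calc ∫ x, strainNormSqAt v x ^ 2 ≤ ∫ x, 9 / 16 * ∑ i, ∑ j, a j i x ^ 4 :=
        integral_mono ((hSc.pow 2).integrable_unitAddTorus) hRi hX
    _ = 9 / 16 * ∑ i, ∑ j, ∫ x, a j i x ^ 4 := by
        rw [integral_const_mul, integral_finsetSum _ (fun i _ => haI2 i)]
        congr 1
        exact Finset.sum_congr rfl fun i _ => integral_finsetSum _ fun j _ => haI i j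
    _ ≤ 9 / 16 * ∑ i : Fin 3, ∑ j : Fin 3,
          (27 * (C : ℝ) ^ 4 * ∫ x, torusVorticitySqAt v x ^ 2) := by
        apply mul_le_mul_of_nonneg_left _ (by norm_num : (0 : ℝ) ≤ 9 / 16)
        exact Finset.sum_le_sum fun i _ => Finset.sum_le_sum fun j _ =>
          (h2 j i).trans (mul_le_mul_of_nonneg_left h3 (by positivity))
    _ = 2187 / 16 * (C : ℝ) ^ 4 * ∫ x, torusVorticitySqAt v x ^ 2 := by
        simp only [Finset.sum_const, Finset.card_univ, Fintype.card_fin, nsmul_eq_mul,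
          Nat.cast_ofNat]
        ring

/-- **`StretchingSupSharp` is FALSE on `T³`** (K1-Q1 decided, unconditionally: the `L⁴`
Calderón–Zygmund constant exists by the tree's periodic CZ theorem, and then
`stretchingSupBound_of_strainL4Bound` beats `2/√3`). Search for candidate a priori estimates; no
regularity claim — this is a statement about one static inequality's optimal constant.
[ours, UNREVIEWED — K1Q1.md] -/
theorem not_stretchingSupSharp_fin3 : ¬ StretchingSupSharp (d := Fin 3) := by
  obtain ⟨K, hK, hCZ⟩ := exists_strainL4Bound_fin3
  exact not_stretchingSupSharp_of_strainL4Bound hK hCZ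

/-- The refutation in the tree's `_refuted` naming: `StretchingSupSharp (d := Fin 3)` is false. -/
theorem stretchingSupSharp_refuted : ¬ StretchingSupSharp (d := Fin 3) :=
  not_stretchingSupSharp_fin3

/-- **K1-Q1, dictionary form: a static stretching constant STRICTLY below Hölder's `2/√3` exists on
`T³`** — `∃ C < 2/√3`, `∫⟪(v·∇)v, Δv⟫ ≤ C·M·ℰ(v)` for every smooth divergence-free `v` with
`|ω| ≤ M`. Search for candidate a priori estimates; no regularity claim. [ours, UNREVIEWED — K1Q1.md] -/
theorem exists_stretchingSupBound_lt_holder :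
    ∃ C : ℝ, C < 2 / Real.sqrt 3 ∧ StretchingSupBound (d := Fin 3) C := by
  obtain ⟨K, hK, hCZ⟩ := exists_strainL4Bound_fin3
  refine ⟨_, ?_, stretchingSupBound_of_strainL4Bound hK hCZ⟩
  have hs3 : 0 < Real.sqrt 3 := Real.sqrt_pos.2 (by norm_num)
  have hpos : 0 < 1 / (4 * Real.sqrt 3 * (4 * K + 1)) := by positivity
  linarith

end L4

end Summit.NavierStokesRegularity.FunctionalMining

end
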